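import Literature.Barriers.CriticalPhenomena.LaceExpansionXSpaceNormsFractional
import Literature.Barriers.CriticalPhenomena.LaceExpansionXSpaceNormsSlices
import HarnessLib

/-!
# The top exponents of Hara's Lemma 1.7: `sup_x |x_j|^φ τ_{p_c}(0,x) < ∞` for `⌊φ⌋ < φ < d - 2`
# (the case `⌊φ⌋ < α ≤ φ` of the `Ḡ`-clause, Hara 2008 §4.1.4) — PROVED

Barrier catalogue `Literature/Barriers/CriticalPhenomena/` (D-0021), support file for the
discharge of the named fact `Hara2008_lemma17Pc` (`LaceExpansionXSpaceNorms.lean`: Hara 2008,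
Lemma 1.7). `LaceExpansionXSpaceNormsProofs.lean` reduced the fact to two analytic inputs and
`LaceExpansionXSpaceNormsFractional.lean` discharged the first; this file discharges the second —
the hypothesis `htop` of `Hara2008_lemma17Pc_of_engines`: for `⌊φ⌋ < α ≤ φ`, `α < d - 2`,
`sup_x |x_j|^α τ_{p_c}(0,x) < ∞`. Hara (§4.1.4, "the most complicated of all the cases") splits
`(i∂_1)^{n-1} Ĝ = P̂ + Q̂`, treats `P` by an `x`-space convolution and `Q` by the fractional kernels of
§4.3–§4.4. Here instead a single finite difference at the scale `π/|x_l|` is used: with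
`F = ∂_l^M Ĝ` (`M = ⌊φ⌋`, `θ = φ - M ∈ (0,1)`) and `h = π/|x_l|`,

  `2 (-ix_l)^M (2π)^d τ_{p_c}(0,x) = (1 - cos(h x_l)) ∫ e^{ik·x} F = ∫ e^{ik·x} Δ²_h F`,

and `∫_{[-π,π]^d} |Δ²_h F| ≤ K h^θ`, whence `|x_l|^{M+θ} τ_{p_c}(0,x) ≤ K π^θ / (2(2π)^d)`. The
`L¹` bound is the modulus split of `LaceExpansionFractionalSmearBounds.lean` at `|k| ≈ 3h` with
`p = 1` and the reference exponent `q = 2 + M + θ < d`: near the origin the envelope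
`|∂_l^M Ĝ| ≤ C/|k|^{2+M}` (Lemma 4.1, `FracSmear.norm_sdiff_le_near`); far from it the TOP-ORDER
Hölder increment `‖∂_l^M Ĝ(s+u) - ∂_l^M Ĝ(s)‖ ≤ B (u^θ ω₀^{-(2+M)} + u ω₀^{-(3+M)})` of
`LaceExpansionXSpaceNormsSlices.lean` (`exists_norm_incr_twoPointSlice_top_le`, from the fractional
moment `Σ_x |x|^{M+θ} |Π(x)| < ∞`), applicable because `ω` is `1`-Lipschitz along coordinate lines
(`HaraNorms.abs_omega_update_sub_le`), so the window `[k_l - h, k_l + h]` stays at distance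
`∈ [2|k|/3, 4|k|/3]` from `2πℤ^d` when `|k| ≥ 3h`.

Contents (all PROVED): `HaraNorms.wrap_add_int_mul`, `HaraNorms.abs_wrap_le_abs_wrap_add`,
`Real.sqrt_sq_add_le_sqrt_sq_add_add`, `HaraNorms.abs_omega_update_sub_le`;
`goodLine_of_removeNth_ne_zero`, `norm_sdiff_le_far_top` (region II at the top order),
`two_mul_div_three_rpow_neg`; `IsLaceCoefficientPc.exists_lintegral_sdiff_top_le`
(`∫ |Δ²_h ∂_l^M Ĝ| ≤ K h^θ`, `0 < h ≤ π/4`); `IsLaceCoefficientPc.exists_coordG_top_le`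
(`sup_x |x_l|^{M+θ} τ_{p_c}(0,x) < ∞`) and `Hara2008_lemma17Pc_htop` (the shape consumed by
`Hara2008_lemma17Pc_of_engines`; note `⌊φ⌋ < α < d - 2` forces `φ < d - 2`).

## References

* T. Hara, Ann. Probab. 36 (2008) 530–593 (arXiv:math-ph/0504021): Lemma 1.7 ((1.30): `Ḡ^{(α)} < ∞`
  if `α ≤ φ` and `α < d - 2`), §4.1.4 (the case `α > ⌊φ⌋`), Lemma 4.1, §4.3 (finite differences vs.
  fractional derivatives: "suitably defined `(n-ε)`th-derivative").
-/

noncomputable section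

namespace Literature.Barriers.CriticalPhenomena

open _root_.MeasureTheory _root_.Filter Finset Literature.Probability.LatticeModels
  Literature.Probability.Percolation HaraNorms FracSmear

open scoped ENNReal NNReal BigOperators Topology

/-! ### `ω` is `1`-Lipschitz along coordinate lines -/

section Lipschitz

variable {d : ℕ}

/-- `wrap` is `2π`-periodic. [folklore] -/
theorem HaraNorms.wrap_add_int_mul (t : ℝ) (n : ℤ) : wrap (t + n * (2 * Real.pi)) = wrap t := by
  rw [wrap, wrap, ← zsmul_eq_mul, toIocMod_add_zsmul]

/-- The distance to `2πℤ` is `1`-Lipschitz: `|wrap t| ≤ |wrap t'| + |t - t'|`. [folklore] -/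
theorem HaraNorms.abs_wrap_le_abs_wrap_add (t t' : ℝ) : |wrap t| ≤ |wrap t'| + |t - t'| := by
  obtain ⟨n, hn⟩ := exists_wrap_eq t'
  calc |wrap t| = |wrap (t + n * (2 * Real.pi))| := by rw [wrap_add_int_mul t n]
    _ ≤ |t + n * (2 * Real.pi)| := abs_wrap_le_abs _
    _ = |(t - t') + wrap t'| := by rw [hn]; ring_nf
    _ ≤ |t - t'| + |wrap t'| := abs_add_le _ _
    _ = |wrap t'| + |t - t'| := add_comm _ _

/-- `√(a² + S)` is `1`-Lipschitz in `a ≥ 0`. [folklore] -/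
theorem Real.sqrt_sq_add_le_sqrt_sq_add_add {a b S : ℝ} (ha : 0 ≤ a) (hb : 0 ≤ b) (hS : 0 ≤ S) :
    Real.sqrt (a ^ 2 + S) ≤ Real.sqrt (b ^ 2 + S) + |a - b| := by
  have hbS : b ≤ Real.sqrt (b ^ 2 + S) := by
    rw [show b = Real.sqrt (b ^ 2) by rw [Real.sqrt_sq hb]]
    exact Real.sqrt_le_sqrt (by rw [Real.sq_sqrt (sq_nonneg b)]; linarith)
  have hab : a ≤ b + |a - b| := by linarith [le_abs_self (a - b)]
  rw [Real.sqrt_le_left (by positivity)]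
  have h0 : 0 ≤ Real.sqrt (b ^ 2 + S) := Real.sqrt_nonneg _
  have h1 : a ^ 2 ≤ (b + |a - b|) ^ 2 := pow_le_pow_left₀ ha hab 2
  have h2 : (Real.sqrt (b ^ 2 + S)) ^ 2 = b ^ 2 + S := Real.sq_sqrt (by positivity)
  nlinarith [abs_nonneg (a - b), h0]

/-- **`ω` is `1`-Lipschitz along the line `t ↦ k[l ↦ t]`**: `|ω(k[l ↦ t]) - ω(k[l ↦ t'])| ≤ |t - t'|`
(`ω² = wrap(t)² + Σ_{i ≠ l} wrap(k_i)²`). [folklore] -/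
theorem HaraNorms.abs_omega_update_sub_le (k : Fin d → ℝ) (l : Fin d) (t t' : ℝ) :
    |omega (Function.update k l t) - omega (Function.update k l t')| ≤ |t - t'| := by
  classical
  set S : ℝ := ∑ i ∈ Finset.univ.erase l, wrap (k i) ^ 2 with hS
  have hS0 : 0 ≤ S := Finset.sum_nonneg fun i _ => sq_nonneg _
  have hdec : ∀ u : ℝ, omega (Function.update k l u) = Real.sqrt (|wrap u| ^ 2 + S) := by
    intro u
    have h1 : omega (Function.update k l u) ^ 2 = |wrap u| ^ 2 + S := by
      rw [omega_sq, ← Finset.add_sum_erase _ _ (Finset.mem_univ l), Function.update_self, sq_abs, hS]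
      congr 1
      refine Finset.sum_congr rfl fun i hi => ?_
      rw [Function.update_of_ne (Finset.ne_of_mem_erase hi)]
    rw [← h1, Real.sqrt_sq (omega_nonneg _)]
  rw [hdec t, hdec t']
  have hw := abs_wrap_le_abs_wrap_add t t'
  have hw' := abs_wrap_le_abs_wrap_add t' t
  rw [abs_sub_comm t' t] at hw'
  have h1 := Real.sqrt_sq_add_le_sqrt_sq_add_add (abs_nonneg (wrap t)) (abs_nonneg (wrap t')) hS0
  have h2 := Real.sqrt_sq_add_le_sqrt_sq_add_add (abs_nonneg (wrap t')) (abs_nonneg (wrap t)) hS0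
  have h3 : |(|wrap t| - |wrap t'|)| ≤ |t - t'| := abs_sub_le_iff.2 ⟨by linarith, by linarith⟩
  rw [abs_sub_comm (|wrap t'|) (|wrap t|)] at h2
  exact abs_sub_le_iff.2 ⟨by linarith, by linarith⟩

end Lipschitz

/-! ### The far-region bound at the top order from the Hölder increment -/

section TopFar

variable {n : ℕ}

/-- A point of the cube with nonzero transverse part lies on a good line. [folklore] -/
theorem goodLine_of_removeNth_ne_zero {k : Fin (n + 1) → ℝ} (hk : k ∈ cube (n + 1)) {l : Fin (n + 1)}
    (hk' : l.removeNth k ≠ 0) : GoodLine k l := by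
  by_contra hng
  apply hk'
  funext j
  have hne : l.succAbove j ≠ l := Fin.succAbove_ne l j
  have hw : wrap (k (l.succAbove j)) = 0 := by
    by_contra hw
    exact hng ⟨l.succAbove j, hne, hw⟩
  have habs : |wrap (k (l.succAbove j))| = |k (l.succAbove j)| :=
    abs_wrap_eq_abs (hk (l.succAbove j) (Set.mem_univ _))
  rw [hw, abs_zero] at habs
  have : k (l.succAbove j) = 0 := abs_eq_zero.1 habs.symm
  simpa [Fin.removeNth] using this

/-- **Region II at the top order.** Let `F` be a function whose values along the line
`t ↦ k[l ↦ t]` are `ψ_k(t)`, and suppose the increments of `ψ_k` on good lines obey the two-term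
bound `‖ψ_k(s+u) - ψ_k(s)‖ ≤ B (u^θ ω₀^{-a} + u ω₀^{-(a+1)})` whenever `ω ∈ [ω₀, 3ω₀]` on `[s, s+u]`
(`0 ≤ u ≤ 1`). Then for `k` in the cube with nonzero transverse part and `|k| ≥ 3h` (`0 < h ≤ 1`),
`‖Δ²_h F(k)‖ ≤ B (h^θ (2|k|/3)^{-a} + h (2|k|/3)^{-(a+1)})` (the window `[k_l - h, k_l + h]` stays at
distance `∈ [2|k|/3, 4|k|/3]` from `2πℤ^d` since `ω` is `1`-Lipschitz along the line).
[cite: Hara2008, §4.1.4 (the case α > ⌊φ⌋, here through increments)] -/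
theorem norm_sdiff_le_far_top {F : (Fin (n + 1) → ℝ) → ℂ} {ψ : (Fin (n + 1) → ℝ) → ℝ → ℂ}
    {l : Fin (n + 1)} {a θ B : ℝ} (hFψ : ∀ k t, F (Function.update k l t) = ψ k t)
    (hincr : ∀ k : Fin (n + 1) → ℝ, GoodLine k l → ∀ (s u ω₀ : ℝ), 0 ≤ u → u ≤ 1 → 0 < ω₀ →
      (∀ t ∈ Set.Icc s (s + u), ω₀ ≤ omega (Function.update k l t) ∧ omega (Function.update k l t) ≤ 3 * ω₀) →
      ‖ψ k (s + u) - ψ k s‖ ≤ B * (u ^ θ * ω₀ ^ (-a) + u * ω₀ ^ (-(a + 1))))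
    {h : ℝ} (h0 : 0 < h) (h1 : h ≤ 1) {k : Fin (n + 1) → ℝ} (hk : k ∈ cube (n + 1))
    (hk' : l.removeNth k ≠ 0) (hII : 3 * h ≤ knorm k) :
    ‖sdiff F l h k‖ ≤ B * (h ^ θ * (2 * knorm k / 3) ^ (-a) + h * (2 * knorm k / 3) ^ (-(a + 1))) := by
  set s := k l with hs
  set R := knorm k with hR
  have hR0 : 0 < R := lt_of_lt_of_le (by linarith) hII
  have hgood : GoodLine k l := goodLine_of_removeNth_ne_zero hk hk'
  set ω₀ : ℝ := 2 * R / 3 with hω₀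
  have hω₀pos : 0 < ω₀ := by positivity
  have hωs : omega (Function.update k l s) = R := by
    rw [hs, Function.update_eq_self, omega_eq_knorm hk]
  -- the window condition around `s`
  have hwin : ∀ t : ℝ, |t - s| ≤ h →
      ω₀ ≤ omega (Function.update k l t) ∧ omega (Function.update k l t) ≤ 3 * ω₀ := by
    intro t ht
    have hL := abs_omega_update_sub_le k l t s
    rw [hωs] at hL
    have hlt : |omega (Function.update k l t) - R| ≤ h := hL.trans ht
    rw [abs_le] at hlt
    constructor
    · rw [hω₀]; linarith
    · rw [hω₀]; linarith
  have hwin1 : ∀ t ∈ Set.Icc s (s + h),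
      ω₀ ≤ omega (Function.update k l t) ∧ omega (Function.update k l t) ≤ 3 * ω₀ := fun t ht =>
    hwin t (abs_le.2 ⟨by linarith [ht.1], by linarith [ht.2]⟩)
  have hwin2 : ∀ t ∈ Set.Icc (s - h) (s - h + h),
      ω₀ ≤ omega (Function.update k l t) ∧ omega (Function.update k l t) ≤ 3 * ω₀ := fun t ht =>
    hwin t (abs_le.2 ⟨by linarith [ht.1], by linarith [ht.2]⟩)
  have hi1 := hincr k hgood s h ω₀ h0.le h1 hω₀pos hwin1
  have hi2 := hincr k hgood (s - h) h ω₀ h0.le h1 hω₀pos hwin2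
  rw [sub_add_cancel] at hi2
  -- the second difference along the line
  have hF0 : F k = ψ k s := by rw [← hFψ k s, hs, Function.update_eq_self]
  have hFp : F (shift l h k) = ψ k (s + h) := by unfold FracSmear.shift; rw [hFψ]
  have hFm : F (shift l (-h) k) = ψ k (s - h) := by unfold FracSmear.shift; rw [hFψ, ← sub_eq_add_neg]
  have hsd : sdiff F l h k = ((ψ k s - ψ k (s + h)) + (ψ k s - ψ k (s - h))) / 2 := by
    unfold FracSmear.sdiff
    rw [hF0, hFp, hFm]; ring
  rw [hsd, norm_div, Complex.norm_two]
  have hX : ‖(ψ k s - ψ k (s + h)) + (ψ k s - ψ k (s - h))‖ ≤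
      2 * (B * (h ^ θ * ω₀ ^ (-a) + h * ω₀ ^ (-(a + 1)))) := by
    calc ‖(ψ k s - ψ k (s + h)) + (ψ k s - ψ k (s - h))‖
        ≤ ‖ψ k s - ψ k (s + h)‖ + ‖ψ k s - ψ k (s - h)‖ := norm_add_le _ _
      _ = ‖ψ k (s + h) - ψ k s‖ + ‖ψ k s - ψ k (s - h)‖ := by rw [norm_sub_rev]
      _ ≤ _ := by linarith
  have : ‖(ψ k s - ψ k (s + h)) + (ψ k s - ψ k (s - h))‖ / 2 ≤ B * (h ^ θ * ω₀ ^ (-a) + h * ω₀ ^ (-(a + 1))) := by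
    rw [div_le_iff₀ two_pos]; linarith
  simpa only [hω₀, hR] using this

end TopFar

/-! ### The `L¹` bound `∫ |Δ²_h ∂_l^M Ĝ| ≤ K h^θ` at the top order -/

section TopL1

variable {n : ℕ} {Φ : Site (n + 1) → ℝ}

/-- `(2R/3)^{-e} = (3/2)^e R^{-e}` for `R ≥ 0`. [folklore] -/
theorem two_mul_div_three_rpow_neg {R e : ℝ} (hR : 0 ≤ R) :
    (2 * R / 3) ^ (-e) = (3 / 2 : ℝ) ^ e * R ^ (-e) := by
  rw [show 2 * R / 3 = (2 / 3 : ℝ) * R by ring, Real.mul_rpow (by norm_num) hR, Real.rpow_neg (by norm_num),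
    ← Real.inv_rpow (by norm_num)]
  norm_num

/-- **`∫_{[-π,π]^d} |Δ²_h ∂_l^M Ĝ| ≤ K h^θ` for `0 < h ≤ π/4`** at `p_c`, when
`Σ_x |x|^{M+θ} |Π(x)| < ∞` with `0 < θ < 1` and `M + θ + 2 < d` (`M ≥ 2`, `Σ_x (1+|x|)^M|Π| < ∞`): the
`L¹`-modulus split at `|k| ≈ 3h` — near the origin the envelope `|∂_l^M Ĝ| ≤ C/|k|^{2+M}` of
Lemma 4.1, far from it the top-order Hölder increment of `LaceExpansionXSpaceNormsSlices.lean` —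
with the single reference integral `∫ |k|^{-(2+M+θ)} < ∞` ("finite for `2 + α < d`").
[cite: Hara2008, §4.1.4 and Lemma 4.1] -/
theorem IsLaceCoefficientPc.exists_lintegral_sdiff_top_le (h : IsLaceCoefficientPc (n + 1) Φ) (hn : 1 ≤ n)
    {M : ℕ} (hM2 : 2 ≤ M) (hmom : Summable fun x => (1 + euclidNorm x) ^ M * |Φ x|) {θ : ℝ}
    (hθ0 : 0 < θ) (hθ1 : θ < 1) (hmomθ : Summable fun x => euclidNorm x ^ ((M : ℝ) + θ) * |Φ x|)
    (hMd : (M : ℝ) + θ + 2 < n + 1) (l : Fin (n + 1)) :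
    ∃ K : ℝ, 0 ≤ K ∧ ∀ h' : ℝ, 0 < h' → h' ≤ Real.pi / 4 →
      ∫⁻ k in cube (n + 1), ‖sdiff (sliceDeriv (kspaceTwoPoint (laceKernel (criticalProbI (n + 1)) Φ)
        (laceSource Φ)) l M) l h' k‖ₑ ≤ ENNReal.ofReal (K * h' ^ θ) := by
  set F := sliceDeriv (kspaceTwoPoint (laceKernel (criticalProbI (n + 1)) Φ) (laceSource Φ)) l M with hFdef
  -- the envelope (Lemma 4.1 at order `M`) and the top increment
  obtain ⟨c₀, hc₀, hlow⟩ := h.exists_knorm_sq_le_norm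
  obtain ⟨C, hC0, hSB⟩ := exists_sliceBound_sliceDeriv_kspaceTwoPoint hM2 (summable_moment_laceKernel hmom _)
    (summable_moment_laceSource hmom) (isZdSymmetric_laceKernel h.symm _) hc₀ hlow l (m := M) (r := 0) (by omega)
  obtain ⟨B, hB0, hB⟩ := exists_norm_incr_twoPointSlice_top_le h hM2 hmom hθ0.le hθ1.le hmomθ
  set a : ℝ := ((2 + M : ℕ) : ℝ) with ha
  have ha' : a = 2 + (M : ℝ) := by rw [ha]; push_cast; ring
  have ha0 : 0 < a := by rw [ha']; positivity
  have hFψ : ∀ (k : Fin (n + 1) → ℝ) (t : ℝ), F (Function.update k l t) = iteratedDeriv M (twoPointSlice Φ k l) t := by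
    intro k t
    rw [hFdef, sliceDeriv_eq_iteratedDeriv_twoPointSlice, twoPointSlice_update, Function.update_self]
  have hincr : ∀ k : Fin (n + 1) → ℝ, GoodLine k l → ∀ (s u ω₀ : ℝ), 0 ≤ u → u ≤ 1 → 0 < ω₀ →
      (∀ t ∈ Set.Icc s (s + u), ω₀ ≤ omega (Function.update k l t) ∧ omega (Function.update k l t) ≤ 3 * ω₀) →
      ‖iteratedDeriv M (twoPointSlice Φ k l) (s + u) - iteratedDeriv M (twoPointSlice Φ k l) s‖ ≤
        B * (u ^ θ * ω₀ ^ (-a) + u * ω₀ ^ (-(a + 1))) := by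
    intro k hk s u ω₀ hu hu1 hω hw
    have := hB k l hk s u ω₀ hu hu1 hω hw
    rwa [ha', show 2 + (M : ℝ) + 1 = 3 + M by ring]
  -- the exponents and the reference integrals
  set q : ℝ := a + θ with hq
  have hqd : q < n + 1 := by rw [hq, ha']; linarith
  have haq : a ≤ q := by rw [hq]; linarith
  have hqa1 : q ≤ a + 1 := by rw [hq]; linarith
  set L := ∫⁻ k in cube (n + 1), ENNReal.ofReal (knorm k ^ (-q)) with hL
  have hLt : L < ⊤ := lintegral_knorm_rpow_neg_lt_top (by omega) (by linarith) hqd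
  set La := ∫⁻ k in cube (n + 1), ENNReal.ofReal (knorm k ^ (-a)) with hLa
  have hLat : La < ⊤ := lintegral_knorm_rpow_neg_lt_top (by omega) ha0.le (by linarith)
  -- the constants
  set Kn : ℝ := C * ((3 : ℝ) ^ θ + 2 * (4 : ℝ) ^ θ) * L.toReal with hKn
  set K1 : ℝ := B * (3 / 2 : ℝ) ^ a * La.toReal with hK1
  set K2 : ℝ := B * (3 / 2 : ℝ) ^ (a + 1) * (3 : ℝ) ^ (θ - 1) * L.toReal with hK2
  have hKn0 : 0 ≤ Kn := by positivity
  have hK10 : 0 ≤ K1 := by positivity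
  have hK20 : 0 ≤ K2 := by positivity
  refine ⟨Kn + K1 + K2, by positivity, fun h' h0 hh => ?_⟩
  have hh1 : h' ≤ 1 := hh.trans (by linarith [Real.pi_le_four])
  have hkc : Continuous (knorm : (Fin (n + 1) → ℝ) → ℝ) := by unfold knorm; fun_prop
  set I : Set (Fin (n + 1) → ℝ) := {k | knorm k < 3 * h'} with hI
  have hIm : MeasurableSet I := measurableSet_lt hkc.measurable measurable_const
  set ψ : ℝ → (Fin (n + 1) → ℝ) → ENNReal := fun t k => ENNReal.ofReal (knorm (shift l t k) ^ (-a)) with hψ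
  set E₁ : ℝ := B * (3 / 2 : ℝ) ^ a * h' ^ θ with hE₁
  set E₂ : ℝ := B * (3 / 2 : ℝ) ^ (a + 1) * (3 : ℝ) ^ (θ - 1) * h' ^ θ with hE₂
  have hE₁0 : 0 ≤ E₁ := by positivity
  have hE₂0 : 0 ≤ E₂ := by positivity
  set A : (Fin (n + 1) → ℝ) → ENNReal := I.indicator fun k => ENNReal.ofReal C * (ψ 0 k + ψ h' k + ψ (-h') k) with hA
  set Bf : (Fin (n + 1) → ℝ) → ENNReal := Iᶜ.indicator fun k =>
    ENNReal.ofReal E₁ * ENNReal.ofReal (knorm k ^ (-a)) + ENNReal.ofReal E₂ * ENNReal.ofReal (knorm k ^ (-q)) with hBf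
  -- pointwise a.e. on the cube
  have hpt : ∀ᵐ k ∂(volume : Measure (Fin (n + 1) → ℝ)).restrict (cube (n + 1)), ‖sdiff F l h' k‖ₑ ≤ A k + Bf k := by
    filter_upwards [ae_restrict_mem (measurableSet_cube _), ae_restrict_of_ae (ae_removeNth_ne_zero hn l)] with k hk hk'
    rw [← ofReal_norm]
    by_cases hkI : k ∈ I
    · -- region I
      have hkI' : knorm k < 3 * h' := hkI
      rw [hA, hBf, Set.indicator_of_mem hkI, Set.indicator_of_notMem (Set.notMem_compl_iff.2 hkI), add_zero]
      have hb := norm_sdiff_le_near hSB h0 hh hk hk' hkI'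
      have hdiv : ∀ u : Fin (n + 1) → ℝ, C / knorm u ^ a = C * knorm u ^ (-a) := fun u => by
        rw [Real.rpow_neg (knorm_nonneg u), div_eq_mul_inv]
      rw [hdiv, hdiv, hdiv] at hb
      have hx : 0 ≤ knorm k ^ (-a) := Real.rpow_nonneg (knorm_nonneg _) _
      have hy : 0 ≤ knorm (shift l h' k) ^ (-a) := Real.rpow_nonneg (knorm_nonneg _) _
      have hz : 0 ≤ knorm (shift l (-h') k) ^ (-a) := Real.rpow_nonneg (knorm_nonneg _) _
      have hb' : ‖sdiff F l h' k‖ ≤ C * (knorm k ^ (-a) + knorm (shift l h' k) ^ (-a) + knorm (shift l (-h') k) ^ (-a)) := by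
        nlinarith
      calc ENNReal.ofReal ‖sdiff F l h' k‖
          ≤ ENNReal.ofReal (C * (knorm k ^ (-a) + knorm (shift l h' k) ^ (-a) + knorm (shift l (-h') k) ^ (-a))) :=
            ENNReal.ofReal_le_ofReal hb'
        _ = ENNReal.ofReal C * (ψ 0 k + ψ h' k + ψ (-h') k) := by
            rw [ENNReal.ofReal_mul hC0, hψ]
            simp only [shift_zero]
            rw [ENNReal.ofReal_add (add_nonneg hx hy) hz, ENNReal.ofReal_add hx hy]
    · -- region II
      have hkII : 3 * h' ≤ knorm k := not_lt.1 hkI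
      have hR0 : 0 < knorm k := lt_of_lt_of_le (by linarith) hkII
      rw [hA, hBf, Set.indicator_of_notMem hkI, Set.indicator_of_mem (Set.mem_compl hkI), zero_add]
      have hb := norm_sdiff_le_far_top hFψ hincr h0 hh1 hk hk' hkII
      rw [two_mul_div_three_rpow_neg hR0.le, two_mul_div_three_rpow_neg hR0.le] at hb
      have hfar2 : knorm k ^ (-(a + 1)) ≤ (3 * h') ^ (q - (a + 1)) * knorm k ^ (-q) :=
        rpow_neg_le_far (by linarith) hkII hqa1
      have hpow : h' * (3 * h') ^ (q - (a + 1)) = (3 : ℝ) ^ (θ - 1) * h' ^ θ := by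
        rw [show q - (a + 1) = θ - 1 by rw [hq]; ring, Real.mul_rpow (by norm_num) h0.le]
        have : h' * h' ^ (θ - 1) = h' ^ θ := by
          rw [← Real.rpow_one_add' h0.le (by linarith), show 1 + (θ - 1) = θ by ring]
        calc h' * ((3 : ℝ) ^ (θ - 1) * h' ^ (θ - 1)) = (3 : ℝ) ^ (θ - 1) * (h' * h' ^ (θ - 1)) := by ring
          _ = _ := by rw [this]
      have hb' : ‖sdiff F l h' k‖ ≤ E₁ * knorm k ^ (-a) + E₂ * knorm k ^ (-q) := by
        have hx : 0 ≤ knorm k ^ (-a) := Real.rpow_nonneg (knorm_nonneg _) _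
        have h32 : 0 ≤ B * (3 / 2 : ℝ) ^ (a + 1) * h' := by positivity
        calc ‖sdiff F l h' k‖
            ≤ B * (h' ^ θ * ((3 / 2 : ℝ) ^ a * knorm k ^ (-a)) + h' * ((3 / 2 : ℝ) ^ (a + 1) * knorm k ^ (-(a + 1)))) := hb
          _ = E₁ * knorm k ^ (-a) + (B * (3 / 2 : ℝ) ^ (a + 1) * h') * knorm k ^ (-(a + 1)) := by rw [hE₁]; ring
          _ ≤ E₁ * knorm k ^ (-a) + (B * (3 / 2 : ℝ) ^ (a + 1) * h') * ((3 * h') ^ (q - (a + 1)) * knorm k ^ (-q)) := by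
              gcongr
          _ = E₁ * knorm k ^ (-a) + E₂ * knorm k ^ (-q) := by
              rw [hE₂]
              calc E₁ * knorm k ^ (-a) + (B * (3 / 2 : ℝ) ^ (a + 1) * h') * ((3 * h') ^ (q - (a + 1)) * knorm k ^ (-q))
                  = E₁ * knorm k ^ (-a) + B * (3 / 2 : ℝ) ^ (a + 1) * (h' * (3 * h') ^ (q - (a + 1))) * knorm k ^ (-q) := by ring
                _ = _ := by rw [hpow]; ring
      calc ENNReal.ofReal ‖sdiff F l h' k‖ ≤ ENNReal.ofReal (E₁ * knorm k ^ (-a) + E₂ * knorm k ^ (-q)) :=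
            ENNReal.ofReal_le_ofReal hb'
        _ = ENNReal.ofReal E₁ * ENNReal.ofReal (knorm k ^ (-a)) + ENNReal.ofReal E₂ * ENNReal.ofReal (knorm k ^ (-q)) := by
            rw [ENNReal.ofReal_add (by positivity) (by positivity), ENNReal.ofReal_mul hE₁0, ENNReal.ofReal_mul hE₂0]
  -- integrate the majorant
  have hBm : Measurable fun k => ENNReal.ofReal E₁ * ENNReal.ofReal (knorm k ^ (-a)) +
      ENNReal.ofReal E₂ * ENNReal.ofReal (knorm k ^ (-q)) :=
    (measurable_const.mul (ENNReal.measurable_ofReal.comp (hkc.measurable.pow_const _))).add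
      (measurable_const.mul (ENNReal.measurable_ofReal.comp (hkc.measurable.pow_const _)))
  have hmain : ∫⁻ k in cube (n + 1), ‖sdiff F l h' k‖ₑ ≤ (∫⁻ k in cube (n + 1), A k) + ∫⁻ k in cube (n + 1), Bf k := by
    calc ∫⁻ k in cube (n + 1), ‖sdiff F l h' k‖ₑ ≤ ∫⁻ k in cube (n + 1), (A k + Bf k) := lintegral_mono_ae hpt
      _ = (∫⁻ k in cube (n + 1), A k) + ∫⁻ k in cube (n + 1), Bf k :=
          lintegral_add_right _ (hBm.indicator hIm.compl)
  -- region I integral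
  have hψm : ∀ t, Measurable (ψ t) := fun t =>
    ENNReal.measurable_ofReal.comp ((hkc.measurable.comp (measurable_shift l t)).pow_const _)
  have hψI : ∀ t, |t| ≤ h' → ∫⁻ k in cube (n + 1) ∩ I, ψ t k ≤ ENNReal.ofReal ((4 * h') ^ (q - a)) * L :=
    fun t ht => lintegral_near_shift_le l h0 hh ht ha0 haq
  have hqa : q - a = θ := by rw [hq]; ring
  have hAint : ∫⁻ k in cube (n + 1), A k ≤ ENNReal.ofReal (Kn * h' ^ θ) := by
    have hm2 : Measurable fun k => ψ 0 k + ψ h' k := (hψm 0).add (hψm h')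
    rw [hA, lintegral_indicator hIm, Measure.restrict_restrict hIm, Set.inter_comm,
      lintegral_const_mul' _ _ ENNReal.ofReal_ne_top, lintegral_add_left hm2, lintegral_add_left (hψm 0)]
    have h1 : ∫⁻ k in cube (n + 1) ∩ I, ψ 0 k ≤ ENNReal.ofReal ((3 * h') ^ (q - a)) * L := by
      calc ∫⁻ k in cube (n + 1) ∩ I, ψ 0 k
          ≤ ∫⁻ k in cube (n + 1) ∩ I, ENNReal.ofReal ((3 * h') ^ (q - a)) * ENNReal.ofReal (knorm k ^ (-q)) := by
            refine setLIntegral_mono' ((measurableSet_cube _).inter hIm) fun k hk => ?_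
            rw [hψ]; simp only [shift_zero]
            rw [← ENNReal.ofReal_mul (Real.rpow_nonneg (by linarith) _)]
            exact ENNReal.ofReal_le_ofReal (rpow_neg_le_near (knorm_nonneg _) hk.2 ha0 haq)
        _ ≤ ENNReal.ofReal ((3 * h') ^ (q - a)) * L := by
            rw [lintegral_const_mul' _ _ ENNReal.ofReal_ne_top]
            exact mul_le_mul' le_rfl (lintegral_mono_set Set.inter_subset_left)
    have h2 := hψI h' (abs_of_pos h0).le
    have h3 := hψI (-h') (by rw [abs_neg]; exact (abs_of_pos h0).le)
    rw [hqa] at h1 h2 h3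
    calc ENNReal.ofReal C * ((∫⁻ k in cube (n + 1) ∩ I, ψ 0 k) + (∫⁻ k in cube (n + 1) ∩ I, ψ h' k) +
          ∫⁻ k in cube (n + 1) ∩ I, ψ (-h') k)
        ≤ ENNReal.ofReal C * (ENNReal.ofReal ((3 * h') ^ θ) * L + ENNReal.ofReal ((4 * h') ^ θ) * L +
            ENNReal.ofReal ((4 * h') ^ θ) * L) := mul_le_mul' le_rfl (add_le_add (add_le_add h1 h2) h3)
      _ = ENNReal.ofReal (Kn * h' ^ θ) := by
          rw [← ENNReal.ofReal_toReal hLt.ne, ← ENNReal.ofReal_mul (Real.rpow_nonneg (by linarith) _),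
            ← ENNReal.ofReal_mul (Real.rpow_nonneg (by linarith) _),
            ← ENNReal.ofReal_add (by positivity) (by positivity), ← ENNReal.ofReal_add (by positivity) (by positivity),
            ← ENNReal.ofReal_mul hC0, hKn, Real.mul_rpow (by norm_num) h0.le, Real.mul_rpow (by norm_num) h0.le]
          congr 1
          ring
  -- region II integral
  have hBint : ∫⁻ k in cube (n + 1), Bf k ≤ ENNReal.ofReal (K1 * h' ^ θ) + ENNReal.ofReal (K2 * h' ^ θ) := by
    have hm1 : Measurable fun k => ENNReal.ofReal E₁ * ENNReal.ofReal (knorm k ^ (-a)) :=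
      measurable_const.mul (ENNReal.measurable_ofReal.comp (hkc.measurable.pow_const _))
    rw [hBf, lintegral_indicator hIm.compl, Measure.restrict_restrict hIm.compl, Set.inter_comm,
      lintegral_add_left hm1, lintegral_const_mul' _ _ ENNReal.ofReal_ne_top,
      lintegral_const_mul' _ _ ENNReal.ofReal_ne_top]
    refine add_le_add ?_ ?_
    · calc ENNReal.ofReal E₁ * ∫⁻ k in cube (n + 1) ∩ Iᶜ, ENNReal.ofReal (knorm k ^ (-a))
          ≤ ENNReal.ofReal E₁ * La := mul_le_mul' le_rfl (lintegral_mono_set Set.inter_subset_left)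
        _ = ENNReal.ofReal (K1 * h' ^ θ) := by
            rw [← ENNReal.ofReal_toReal hLat.ne, ← ENNReal.ofReal_mul hE₁0, hE₁, hK1]
            congr 1; ring
    · calc ENNReal.ofReal E₂ * ∫⁻ k in cube (n + 1) ∩ Iᶜ, ENNReal.ofReal (knorm k ^ (-q))
          ≤ ENNReal.ofReal E₂ * L := mul_le_mul' le_rfl (lintegral_mono_set Set.inter_subset_left)
        _ = ENNReal.ofReal (K2 * h' ^ θ) := by
            rw [← ENNReal.ofReal_toReal hLt.ne, ← ENNReal.ofReal_mul hE₂0, hE₂, hK2]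
            congr 1; ring
  calc ∫⁻ k in cube (n + 1), ‖sdiff F l h' k‖ₑ ≤ (∫⁻ k in cube (n + 1), A k) + ∫⁻ k in cube (n + 1), Bf k := hmain
    _ ≤ ENNReal.ofReal (Kn * h' ^ θ) + (ENNReal.ofReal (K1 * h' ^ θ) + ENNReal.ofReal (K2 * h' ^ θ)) :=
        add_le_add hAint hBint
    _ = ENNReal.ofReal ((Kn + K1 + K2) * h' ^ θ) := by
        have hhθ : 0 ≤ h' ^ θ := Real.rpow_nonneg h0.le _
        rw [← ENNReal.ofReal_add (by positivity) (by positivity), ← ENNReal.ofReal_add (by positivity) (by positivity)]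
        congr 1; ring

end TopL1

/-! ### The top engine: `sup_x |x_l|^{M+θ} τ_{p_c}(0,x) < ∞` -/

section TopEngine

variable {n : ℕ} {Φ : Site (n + 1) → ℝ}

/-- **Hara 2008, Lemma 1.7, the case `⌊φ⌋ < α ≤ φ` of the `Ḡ`-clause (§4.1.4), proved.** For a
lace-expansion coefficient `Φ = Π_{p_c}` with `Σ_x (1+|x|)^M |Π(x)| < ∞` (`M ≥ 2`) and the fractional
moment `Σ_x |x|^{M+θ} |Π(x)| < ∞` (`0 < θ < 1`), and `M + θ + 2 < d`: `sup_x |x_l|^{M+θ} τ_{p_c}(0,x) < ∞`.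
Mechanism: for `|x_l| ≥ 4` and `h = π/|x_l|`, the Fourier coefficient of the second difference
`Δ²_h ∂_l^M Ĝ` at `x` is `(1 - cos(h x_l)) (-ix_l)^M (2π)^d τ_{p_c}(0,x) = 2 (-ix_l)^M (2π)^d τ_{p_c}(0,x)`
((4.8) and `FracSmear.setIntegral_cube_cexp_mul_sdiff`), while `∫ |Δ²_h ∂_l^M Ĝ| ≤ K h^θ`
(`exists_lintegral_sdiff_top_le`); hence `|x_l|^{M+θ} τ ≤ K π^θ / (2 (2π)^d)`. This replaces Hara's
`P/Q` split and the fractional kernels of §4.3–§4.4 by a single finite difference at the scale `π/|x_l|`.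
[cite: Hara2008, Lemma 1.7 ((1.30), α ≤ φ) and §4.1.4] -/
theorem IsLaceCoefficientPc.exists_coordG_top_le (h : IsLaceCoefficientPc (n + 1) Φ) (hn : 1 ≤ n)
    {M : ℕ} (hM2 : 2 ≤ M) (hmom : Summable fun x => (1 + euclidNorm x) ^ M * |Φ x|) {θ : ℝ}
    (hθ0 : 0 < θ) (hθ1 : θ < 1) (hmomθ : Summable fun x => euclidNorm x ^ ((M : ℝ) + θ) * |Φ x|)
    (hMd : (M : ℝ) + θ + 2 < n + 1) (l : Fin (n + 1)) :
    ∃ C : ℝ, ∀ x : Site (n + 1), coordG (n + 1) ((M : ℝ) + θ) l x ≤ C := by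
  set F := sliceDeriv (kspaceTwoPoint (laceKernel (criticalProbI (n + 1)) Φ) (laceSource Φ)) l M with hFdef
  obtain ⟨K, hK0, hK⟩ := h.exists_lintegral_sdiff_top_le hn hM2 hmom hθ0 hθ1 hmomθ hMd l
  have hMd' : M + 2 < n + 1 := by
    have : (M : ℝ) + 2 < n + 1 := by linarith
    exact_mod_cast this
  obtain ⟨c₀, hc₀, hlow⟩ := h.exists_knorm_sq_le_norm
  have hFint : IntegrableOn F (cube (n + 1)) :=
    integrableOn_sliceDeriv_kspaceTwoPoint hM2 (summable_moment_laceKernel hmom _) (summable_moment_laceSource hmom)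
      (isZdSymmetric_laceKernel h.symm _) hc₀ hlow l le_rfl hMd'
  have hper : IsPeriodicIn l F := isPeriodicIn_sliceDeriv_kspaceTwoPoint l M
  have hFs : ∀ t : ℝ, IntegrableOn (fun k => F (shift l t k)) (cube (n + 1)) := fun t =>
    hper.integrableOn_comp_shift hFint (h.aestronglyMeasurable_sliceDeriv_shift hmom l l le_rfl t)
  have h2πpos : (0 : ℝ) < (2 * Real.pi) ^ (n + 1) := by positivity
  set D : ℝ := K * Real.pi ^ θ / (2 * (2 * Real.pi) ^ (n + 1)) with hD
  refine ⟨max ((3 : ℝ) ^ ((M : ℝ) + θ)) D, fun x => ?_⟩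
  set X : ℝ := |((x l : ℤ) : ℝ)| with hX
  have hX0 : 0 ≤ X := abs_nonneg _
  have hτ0 := tau_nonneg (criticalProbI (n + 1)) 0 x
  have hτ1 := tau_le_one (criticalProbI (n + 1)) 0 x
  have hMθ : 0 ≤ (M : ℝ) + θ := by positivity
  by_cases hx : X ≤ 3
  · -- small coordinate
    calc coordG (n + 1) ((M : ℝ) + θ) l x = X ^ ((M : ℝ) + θ) * tau (n + 1) (criticalProbI (n + 1)) 0 x := rfl
      _ ≤ (3 : ℝ) ^ ((M : ℝ) + θ) * 1 :=
          mul_le_mul (Real.rpow_le_rpow hX0 hx hMθ) hτ1 hτ0 (Real.rpow_nonneg (by norm_num) _)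
      _ = (3 : ℝ) ^ ((M : ℝ) + θ) := mul_one _
      _ ≤ _ := le_max_left _ _
  · -- large coordinate: `X ≥ 4`
    have hx4 : 4 ≤ X := by
      have h3 : (3 : ℝ) < X := not_le.1 hx
      have h3' : (3 : ℝ) < ((|x l| : ℤ) : ℝ) := by rw [Int.cast_abs]; exact h3
      have h4 : (3 : ℤ) < |x l| := by exact_mod_cast h3'
      have h5 : (4 : ℤ) ≤ |x l| := h4
      have h6 : (4 : ℝ) ≤ ((|x l| : ℤ) : ℝ) := by exact_mod_cast h5
      rwa [Int.cast_abs] at h6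
    have hXpos : 0 < X := by linarith
    set h' : ℝ := Real.pi / X with hh'
    have h0 : 0 < h' := div_pos Real.pi_pos hXpos
    have hh : h' ≤ Real.pi / 4 := div_le_div_of_nonneg_left Real.pi_pos.le (by norm_num) hx4
    -- the Fourier identity for the second difference
    have hid := setIntegral_cube_cexp_mul_sdiff l hper hFint (hFs h') (hFs (-h')) x
    have hcos : Real.cos (h' * ((x l : ℤ) : ℝ)) = -1 := by
      rcases le_or_gt 0 ((x l : ℤ) : ℝ) with hpos | hneg
      · have hXe : X = ((x l : ℤ) : ℝ) := abs_of_nonneg hpos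
        rw [hh', hXe, div_mul_cancel₀ _ (by rw [← hXe]; exact hXpos.ne'), Real.cos_pi]
      · have hXe : X = -((x l : ℤ) : ℝ) := abs_of_neg hneg
        have : h' * ((x l : ℤ) : ℝ) = -Real.pi := by
          rw [hh', hXe, div_neg, neg_mul, div_mul_cancel₀ _ hneg.ne]
        rw [this, Real.cos_neg, Real.cos_pi]
    have hFid := h.integral_cexp_kdot_mul_sliceDeriv hM2 hmom l (le_refl M) hMd' x
    -- `‖LHS‖ ≤ K h^θ`
    have hmeas_sd : AEStronglyMeasurable (fun k => sdiff F l h' k)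
        ((volume : Measure (Fin (n + 1) → ℝ)).restrict (cube (n + 1))) :=
      (hFint.sub (((hFs h').add (hFs (-h'))).div_const 2)).aestronglyMeasurable
    have hLHS : ‖∫ k in cube (n + 1), Complex.exp (Complex.I * (kdot k x : ℂ)) * sdiff F l h' k‖ ≤ K * h' ^ θ := by
      calc ‖∫ k in cube (n + 1), Complex.exp (Complex.I * (kdot k x : ℂ)) * sdiff F l h' k‖
          ≤ ∫ k in cube (n + 1), ‖Complex.exp (Complex.I * (kdot k x : ℂ)) * sdiff F l h' k‖ :=
            norm_integral_le_integral_norm _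
        _ = ∫ k in cube (n + 1), ‖sdiff F l h' k‖ := by
            refine setIntegral_congr_fun (measurableSet_cube _) fun k _ => ?_
            rw [norm_mul, norm_cexp_I_mul_kdot, one_mul]
        _ = (∫⁻ k in cube (n + 1), ‖sdiff F l h' k‖ₑ).toReal := integral_norm_eq_lintegral_enorm hmeas_sd
        _ ≤ (ENNReal.ofReal (K * h' ^ θ)).toReal := ENNReal.toReal_mono ENNReal.ofReal_ne_top (hK h' h0 hh)
        _ = K * h' ^ θ := ENNReal.toReal_ofReal (by positivity)
    -- `‖RHS‖ = 2 X^M (2π)^d τ`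
    have hRHS : ‖(((1 - Real.cos (h' * ((x l : ℤ) : ℝ)) : ℝ) : ℂ) *
        ∫ k in cube (n + 1), Complex.exp (Complex.I * (kdot k x : ℂ)) * F k)‖ =
        2 * (X ^ M * ((2 * Real.pi) ^ (n + 1) * tau (n + 1) (criticalProbI (n + 1)) 0 x)) := by
      rw [hcos, hFid, norm_mul, norm_mul, norm_mul, Complex.norm_real, norm_pow, norm_neg, norm_mul, Complex.norm_I,
        one_mul, Complex.norm_intCast, norm_two_pi_pow, Complex.norm_real, Real.norm_eq_abs, Real.norm_eq_abs,
        abs_of_nonneg hτ0, ← hX]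
      norm_num
    have key : 2 * (X ^ M * ((2 * Real.pi) ^ (n + 1) * tau (n + 1) (criticalProbI (n + 1)) 0 x)) ≤
        K * (Real.pi ^ θ * X ^ (-θ)) := by
      have h1 : K * h' ^ θ = K * (Real.pi ^ θ * X ^ (-θ)) := by
        rw [hh', Real.div_rpow Real.pi_pos.le hX0, Real.rpow_neg hX0, div_eq_mul_inv]
      rw [← hRHS, ← hid, ← h1]
      exact hLHS
    calc coordG (n + 1) ((M : ℝ) + θ) l x = X ^ ((M : ℝ) + θ) * tau (n + 1) (criticalProbI (n + 1)) 0 x := rfl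
      _ = X ^ θ * X ^ M * tau (n + 1) (criticalProbI (n + 1)) 0 x := by
          rw [Real.rpow_add hXpos, Real.rpow_natCast]; ring
      _ = (X ^ θ / (2 * (2 * Real.pi) ^ (n + 1))) *
            (2 * (X ^ M * ((2 * Real.pi) ^ (n + 1) * tau (n + 1) (criticalProbI (n + 1)) 0 x))) := by
          field_simp
      _ ≤ (X ^ θ / (2 * (2 * Real.pi) ^ (n + 1))) * (K * (Real.pi ^ θ * X ^ (-θ))) :=
          mul_le_mul_of_nonneg_left key (by positivity)
      _ = D * (X ^ θ * X ^ (-θ)) := by rw [hD]; ring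
      _ = D := by rw [← Real.rpow_add hXpos, add_neg_cancel, Real.rpow_zero, mul_one]
      _ ≤ _ := le_max_right _ _

/-- **The top engine of `Hara2008_lemma17Pc`** — the hypothesis `htop` of
`Hara2008_lemma17Pc_of_engines` discharged: for `d ≥ 11`, a lace-expansion coefficient with
`Σ_x |x|^φ |Π(x)| < ∞` (`φ ≥ 2`), and `⌊φ⌋ < α ≤ φ`, `α < d - 2`: `sup_y |y_j|^α τ_{p_c}(0,y) < ∞`
(then `φ ∉ ℤ`, `φ < d - 2`, and `|y_j|^α ≤ |y_j|^φ` on `ℤ`). [cite: Hara2008, Lemma 1.7 ((1.30)) and §4.1.4] -/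
theorem Hara2008_lemma17Pc_htop :
    ∀ (d : ℕ), 11 ≤ d → ∀ Φ : Site d → ℝ, IsLaceCoefficientPc d Φ → ∀ φ : ℝ, 2 ≤ φ →
      (Summable fun x : Site d => euclidNorm x ^ φ * |Φ x|) →
      ∀ (j : Fin d) (α : ℝ), (⌊φ⌋₊ : ℝ) < α → α ≤ φ → α < (d : ℝ) - 2 →
        ∃ C : ℝ, ∀ y, coordG d α j y ≤ C := by
  intro d hd Φ hΦ φ hφ2 hmom j α hMα hαφ hαd
  obtain ⟨n, rfl⟩ : ∃ n, d = n + 1 := ⟨d - 1, by omega⟩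
  set M : ℕ := ⌊φ⌋₊ with hM
  set θ : ℝ := φ - M with hθ
  have hφ0 : 0 ≤ φ := by linarith
  have hMφ : (M : ℝ) ≤ φ := Nat.floor_le hφ0
  have hθ0 : 0 < θ := by rw [hθ]; linarith
  have hθ1 : θ < 1 := by
    have := Nat.lt_floor_add_one φ
    rw [hθ]; linarith
  have hM2 : 2 ≤ M := Nat.le_floor (by exact_mod_cast hφ2)
  -- `φ < d - 2`: otherwise `⌊φ⌋ ≥ d - 2 > α`
  have hφd : φ < ((n + 1 : ℕ) : ℝ) - 2 := by
    by_contra hge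
    have hge' : ((n + 1 : ℕ) : ℝ) - 2 ≤ φ := not_lt.1 hge
    have h1 : ((n - 1 : ℕ) : ℝ) ≤ φ := by
      have : ((n - 1 : ℕ) : ℝ) = ((n + 1 : ℕ) : ℝ) - 2 := by
        rw [Nat.cast_sub (by omega)]; push_cast; ring
      rw [this]; exact hge'
    have h2 : n - 1 ≤ M := Nat.le_floor h1
    have h3 : ((n - 1 : ℕ) : ℝ) ≤ M := by exact_mod_cast h2
    have h4 : ((n - 1 : ℕ) : ℝ) = ((n + 1 : ℕ) : ℝ) - 2 := by
      rw [Nat.cast_sub (by omega)]; push_cast; ring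
    linarith
  have hmomM : Summable fun x => (1 + euclidNorm x) ^ M * |Φ x| :=
    summable_one_add_pow_mul_abs_of_rpow hMφ hΦ.summable_abs hmom
  have hmomθ : Summable fun x => euclidNorm x ^ ((M : ℝ) + θ) * |Φ x| := by
    rw [show (M : ℝ) + θ = φ by rw [hθ]; ring]; exact hmom
  have hMd : (M : ℝ) + θ + 2 < n + 1 := by
    rw [show (M : ℝ) + θ = φ by rw [hθ]; ring]
    push_cast at hφd
    linarith
  obtain ⟨C, hC⟩ := hΦ.exists_coordG_top_le (by omega) hM2 hmomM hθ0 hθ1 hmomθ hMd j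
  refine ⟨C, fun y => le_trans ?_ (hC y)⟩
  rw [show (M : ℝ) + θ = φ by rw [hθ]; ring]
  exact coordG_mono (lt_trans (by positivity) hMα) hαφ j y

end TopEngine




end Literature.Barriers.CriticalPhenomena
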